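import Summits.CriticalPhenomena.CardyFormulaZ2.Theorems.ParafermionPrecompact.Negative.ParafermionPrecompactFalseOfUniformInnerEnvelope

/-!
# StrategistCensusR1 — kernel-checked companion of STRATEGY-CENSUS.md, generation 3 (redirect strategist r1),
# crux `CardySusyWard.ParafermionPrecompact` (stmt-CriticalPhenomena-11293)

Seat `planner-cstrat-stmt-CriticalPhenomena-11293-r1-0`, 2026-08-17.  Generations 1–2 (`StrategistCensus.lean`,
`StrategistCensus2.lean`, crux dir) certified: `typed ↔ ¬H` (p74235), `line_decides_notH`, `split_child_false_of_H`,
`typed_of_boundAboveThird`, `canonical_split`, `bulkNondegenerate_of_localisedMass`, `strengthened_refuted`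
(`¬(typed ∧ AnchorLayerSmall)`), `typed_implies_not_UIE`.

This file adds the one new typed object of the generation-3 census, the **COLLAR DICHOTOMY** of the typed text
(§Decomposition / §Negation of STRATEGY-CENSUS.md gen 3):

* `collarSum E δ h` / `farSum E δ h` : the split of the total spin-`1/3` vertex observable `Σ_{p ∈ S_max} F_δ(p)` of
  admissible data on the diagonal anchor square into the boundary COLLAR (medial point at distance `< h` from `Ωᶜ`)
  and the FAR part (`total_eq_collar_add_far`), and the one-scale count `‖farSum‖ ≤ 50 B/δ²` whenever
  `‖F_δ‖ ≤ B` at distance `≥ h` (`norm_farSum_le`);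
* `collar_lower` / `typed_collar_lower` : the typed decl (= vanishing of `δ^{-1/3}F_δ` on compacts) forces, along the
  concrete anchor family of `totalVertexSum_lower` (p138858, unconditional), **every** boundary collar, however thin,
  to carry signed mass `≥ (c/2) δ^{-5/3}` eventually — the quantitative form of "under the typed text all of the
  anchor first moment sits on the wall";
* `CollarSmall` : the hypothesis-free collar statement "for every `η > 0` some fixed collar width `h > 0` carries
  `≤ η δ^{-5/3}` frequently" — strictly WEAKER in shape than crux 11387's uniform inner envelope (signed, integrated,
  one domain; `UIE` gives it with `‖collarSum_h‖ ≤ 480 C (4h)^{2/3} δ^{-5/3}` by the near half of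
  `TotalSmall.norm_totalVertexSum_le`) — and the certified edges `CollarSmall → ¬typed` (`typed_false_of_collarSmall`)
  and `CollarSmall → H` (`H_of_collarSmall`): a refutation target for this item sitting between `UIE` and `H`;
* `closes_vacuous_of_H` : bookkeeping for the tribunal — under `H` the route's deciding theorem can never be fed at
  this binder (and under `¬H` the binder is free, gen-1 `typed_of_notH`), so the binder carries exactly `¬H`.

No `sorry`; axioms expected: propext, Classical.choice, Quot.sound.
-/

noncomputable section

namespace Summit.CriticalPhenomena.CardyFormulaZ2.Cruxes.ParafermionPrecompact.StrategistCensusR1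

open MeasureTheory Filter Set Metric
open scoped Topology BigOperators
open Literature.Probability.LatticeModels
open Literature.Probability.RandomPlanarGeometry (DobrushinDomain)
open Literature.Barriers.CriticalPhenomena (medialVertexOf)
open Summit.CriticalPhenomena.CardyFormulaZ2.Theses.CardySusyWard (ParafermionPrecompact)
open Summit.CriticalPhenomena.CardyFormulaZ2.Cruxes.EdgePrecompact.QkzStripBoundaryArm (cornerObs UniformInnerEnvelope)
open Summit.CriticalPhenomena.CardyFormulaZ2.Theorems.ParafermionPrecompact.Negative (IsFamily VanishesOn
  parafermionPrecompact_iff_vanishing parafermionPrecompact_iff_not_bulkNondegenerate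
  ParafermionPrecompact_false_of_UniformInnerEnvelope not_parafermionPrecompact_iff_bulkNondegenerate)
open Summit.CriticalPhenomena.CardyFormulaZ2.Theorems.ParafermionFamiliesToSLESix.StripAnchored
open Summit.CriticalPhenomena.CardyFormulaZ2.Theorems.ParafermionFamiliesToSLESix.StripAnchored.TotalSmall
  (finite_random card_le_sq card_fiber_le mem_meshDomain_of_random le_infDist_meshPoint cast_dep norm_vertexObs_le_profile)
open Summit.CriticalPhenomena.CardyFormulaZ2.Theorems.ParafermionFamiliesToSLESix.StripAnchored.S5
  (anchorDomain anchor_geometry anchor_level_nonneg)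

/-! ## §0 Tribunal bookkeeping -/

/-- Under `H` (Duminil-Copin–Smirnov bulk non-degeneracy) the typed crux is contradictory, so whatever else is
proved, the route's `closes` is never fed at this binder; with gen-1 `typed_of_notH` the binder carries exactly
`¬H`. [folklore] -/
theorem closes_vacuous_of_H (hH : ParafermionBulkNondegenerate) (hP : ParafermionPrecompact) :
    _root_.CardyFormulaZ2 :=
  absurd hP (not_parafermionPrecompact_iff_bulkNondegenerate.2 hH)

/-! ## §1 The collar / far split of the total vertex observable -/

open Classical in
/-- The COLLAR part of `totalVertexSum`: the sum of the spin-`1/3` vertex observable over the random both-faces-inner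
medial vertices of `E` whose medial point (at mesh `δ`) is at distance `< h` from the complement of the anchor
carrier. [folklore] -/
def collarSum (E : DiscreteDobrushin) (δ h : ℝ) : ℂ :=
  ∑ᶠ p : Site 2 × Fin 2,
    if IsRandomMV E p ∧ infDist (medialPoint δ (medialVertexOf p)) anchorDomain.carrierᶜ < h
    then vertexObs E δ (medialVertexOf p) else 0

open Classical in
/-- The FAR part of `totalVertexSum`: random both-faces-inner medial vertices at distance `≥ h` from the complement
of the anchor carrier. [folklore] -/
def farSum (E : DiscreteDobrushin) (δ h : ℝ) : ℂ :=
  ∑ᶠ p : Site 2 × Fin 2,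
    if IsRandomMV E p ∧ h ≤ infDist (medialPoint δ (medialVertexOf p)) anchorDomain.carrierᶜ
    then vertexObs E δ (medialVertexOf p) else 0

/-- For admissible data the total vertex sum splits as collar + far (all three `finsum`s are finite sums over the
random vertices). [folklore] -/
theorem total_eq_collar_add_far {E : DiscreteDobrushin} (hE : E.IsZdAdmissible) (δ h : ℝ) :
    totalVertexSum E δ = collarSum E δ h + farSum E δ h := by
  classical
  set RS := (finite_random hE).toFinset with hRSdef
  have hRS : ∀ p, p ∈ RS ↔ IsRandomMV E p := fun p => Set.Finite.mem_toFinset _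
  unfold totalVertexSum collarSum farSum
  rw [finsum_eq_sum_of_support_subset (s := RS), finsum_eq_sum_of_support_subset (s := RS),
    finsum_eq_sum_of_support_subset (s := RS), ← Finset.sum_add_distrib]
  · refine Finset.sum_congr rfl fun p hp => ?_
    have hR : IsRandomMV E p := (hRS p).1 hp
    by_cases hlt : infDist (medialPoint δ (medialVertexOf p)) anchorDomain.carrierᶜ < h
    · rw [if_pos hR, if_pos ⟨hR, hlt⟩, if_neg (fun hc => not_le.2 hlt hc.2), add_zero]
    · rw [if_pos hR, if_neg (fun hc => hlt hc.2), if_pos ⟨hR, not_lt.1 hlt⟩, zero_add]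
  all_goals
    intro p hp
    have hc := (ite_ne_right_iff.1 (Function.mem_support.1 hp)).1
    first
      | exact Finset.mem_coe.2 ((hRS p).2 hc)
      | exact Finset.mem_coe.2 ((hRS p).2 hc.1)

/-- **The far part at one scale.** Admissible data on the anchor square at mesh `δ ≤ 1`, lattice diamond of size
`L` (`Lδ < 2 ≤ (L+1)δ`): if `‖F_δ‖ ≤ B` at the random vertices at distance `≥ h` from `Ωᶜ`, then
`‖farSum‖ ≤ 50 B/δ²` (there are at most `2(2L+1)² ≤ 50/δ²` random vertices). [folklore] -/
theorem norm_farSum_le {E : DiscreteDobrushin} {δ : ℝ} {L : ℤ} (hE : E.IsZdAdmissible) (hEδ : E.δ = δ)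
    (hLδ : (L : ℝ) * δ < 2) (hL1 : 2 ≤ ((L : ℝ) + 1) * δ)
    (hmesh : ∀ v : Site 2, v ∈ meshDomain E.Ω δ ↔ |v 0 + v 1| ≤ L ∧ |v 0 - v 1| ≤ L) (hδ1 : δ ≤ 1)
    {h B : ℝ} (hB : 0 ≤ B)
    (hVan : ∀ p : Site 2 × Fin 2, h ≤ infDist (medialPoint δ (medialVertexOf p)) anchorDomain.carrierᶜ →
      ‖vertexObs E δ (medialVertexOf p)‖ ≤ B) :
    ‖farSum E δ h‖ ≤ 50 / δ ^ 2 * B := by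
  classical
  have hδ : 0 < δ := hEδ ▸ hE.delta_pos
  have hL0 : 0 ≤ L := anchor_level_nonneg hδ hL1
  have hL0' : (0:ℝ) ≤ L := by exact_mod_cast hL0
  have h2L : 2 * (L : ℝ) + 1 ≤ 5 / δ := by
    rw [le_div_iff₀ hδ]; nlinarith
  set RS := (finite_random hE).toFinset with hRSdef
  have hRS : ∀ p, p ∈ RS ↔ IsRandomMV E p := fun p => Set.Finite.mem_toFinset _
  have hdia : ∀ p ∈ RS, |p.1 0 + p.1 1| ≤ L ∧ |p.1 0 - p.1 1| ≤ L := fun p hp =>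
    (hmesh p.1).1 (hEδ ▸ (mem_meshDomain_of_random ((hRS p).1 hp)).1)
  have hcnt : (RS.card : ℝ) ≤ 50 / δ ^ 2 := by
    refine (card_le_sq hL0 hdia).trans ?_
    have h1 : (2 * (L : ℝ) + 1) ^ 2 ≤ (5 / δ) ^ 2 := pow_le_pow_left₀ (by positivity) h2L 2
    rw [div_pow] at h1
    have h2 : 2 * (25 / δ ^ 2) = 50 / δ ^ 2 := by ring
    nlinarith
  have hsum : ‖farSum E δ h‖ ≤ ∑ p ∈ RS, B := by
    unfold farSum
    rw [finsum_eq_sum_of_support_subset (s := RS)]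
    · refine (norm_sum_le _ _).trans (Finset.sum_le_sum fun p hp => ?_)
      split_ifs with hc
      · exact hVan p hc.2
      · simpa using hB
    · intro p hp
      have hc := (ite_ne_right_iff.1 (Function.mem_support.1 hp)).1
      exact Finset.mem_coe.2 ((hRS p).2 hc.1)
  calc ‖farSum E δ h‖ ≤ ∑ p ∈ RS, B := hsum
    _ = (RS.card : ℝ) * B := by rw [Finset.sum_const, nsmul_eq_mul]
    _ ≤ 50 / δ ^ 2 * B := mul_le_mul_of_nonneg_right hcnt hB

/-! ## §2 The collar dichotomy of the typed text -/

/-- The arithmetic of the scale: `50/δ² · (ε δ^{1/3}) = 50 ε δ^{-5/3}`. [folklore] -/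
theorem far_scale_identity {δ ε : ℝ} (hδ : 0 < δ) :
    50 / δ ^ 2 * (ε * δ ^ ((1:ℝ) / 3)) = 50 * ε * δ ^ (-(5:ℝ) / 3) := by
  have h : δ ^ (-(5:ℝ) / 3) = δ ^ ((1:ℝ) / 3) / δ ^ 2 := by
    rw [show (-(5:ℝ) / 3) = (1:ℝ) / 3 - 2 by norm_num, Real.rpow_sub hδ, Real.rpow_two]
  rw [h]
  field_simp

/-- **Collar lower bound.** Along a discretisation family `Λ` of the diagonal anchor square whose total vertex sum is
eventually `≥ c δ^{-5/3}` (`c > 0`), vanishing of `δ^{-1/3}F_δ` on compacts forces EVERY boundary collar, of any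
fixed width `h > 0`, to carry signed mass `≥ (c/2) δ^{-5/3}` eventually: the far part is `≤ 50 ε δ^{-5/3}` with
`ε = c/100` on the compact `K_h = {z | h ≤ dist(z, Ωᶜ)}`. [folklore] -/
theorem collar_lower {Λ : ℝ → DiscreteDobrushin} (hΛ : IsFamily anchorDomain Λ) {c : ℝ} (hc : 0 < c)
    (hbig : ∀ᶠ δ in 𝓝[>] (0:ℝ), c * δ ^ (-(5:ℝ) / 3) ≤ ‖totalVertexSum (Λ δ) δ‖)
    (hV : VertexVanishes anchorDomain Λ) {h : ℝ} (hh : 0 < h) :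
    ∀ᶠ δ in 𝓝[>] (0:ℝ), c / 2 * δ ^ (-(5:ℝ) / 3) ≤ ‖collarSum (Λ δ) δ h‖ := by
  set K : Set ℂ := {z | h ≤ infDist z anchorDomain.carrierᶜ} with hKdef
  have hKD : K ⊆ anchorDomain.carrier := by
    intro z hz
    by_contra hzD
    have h0 : infDist z anchorDomain.carrierᶜ = 0 := Metric.infDist_zero_of_mem hzD
    have : h ≤ infDist z anchorDomain.carrierᶜ := hz
    linarith
  have hK : IsCompact K :=
    Metric.isCompact_of_isClosed_isBounded (isClosed_le continuous_const (Metric.continuous_infDist_pt _))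
      (anchorDomain.isBounded.subset hKD)
  have hε : (0:ℝ) < c / 100 := by positivity
  filter_upwards [anchor_geometry hΛ, hV K hK hKD (c / 100) hε, hbig, Ioo_mem_nhdsGT (zero_lt_one' ℝ)]
    with δ hgeom hVan hge hδI
  obtain ⟨hδ0, hδ1⟩ := hδI
  obtain ⟨L, -, hLδ, hL1, hE, hEδ, -, hmesh, -⟩ := hgeom
  have hVan' : ∀ p : Site 2 × Fin 2, h ≤ infDist (medialPoint δ (medialVertexOf p)) anchorDomain.carrierᶜ →
      ‖vertexObs (Λ δ) δ (medialVertexOf p)‖ ≤ c / 100 * δ ^ ((1:ℝ) / 3) := fun p hp => hVan (medialVertexOf p) hp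
  have hfar := norm_farSum_le hE hEδ hLδ hL1 hmesh hδ1.le (by positivity) hVan'
  rw [far_scale_identity hδ0] at hfar
  have hsplit : ‖totalVertexSum (Λ δ) δ‖ ≤ ‖collarSum (Λ δ) δ h‖ + ‖farSum (Λ δ) δ h‖ := by
    rw [total_eq_collar_add_far hE δ h]; exact norm_add_le _ _
  have hpow : (0:ℝ) < δ ^ (-(5:ℝ) / 3) := Real.rpow_pos_of_pos hδ0 _
  nlinarith

/-- **The typed decl puts the whole anchor first moment on the wall.** `ParafermionPrecompact` AS TYPED (= vanishing,
`parafermionPrecompact_iff_vanishing`) gives, for the concrete anchor family of `totalVertexSum_lower` (p138858,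
unconditional), a `c > 0` such that every collar of every fixed width `h > 0` carries `‖collarSum_h‖ ≥ c δ^{-5/3}`
eventually in `δ`. [folklore] -/
theorem typed_collar_lower (hP : ParafermionPrecompact) :
    ∃ Λ : ℝ → DiscreteDobrushin, IsFamily anchorDomain Λ ∧ ∃ c : ℝ, 0 < c ∧ ∀ h : ℝ, 0 < h →
      ∀ᶠ δ in 𝓝[>] (0:ℝ), c * δ ^ (-(5:ℝ) / 3) ≤ ‖collarSum (Λ δ) δ h‖ := by
  obtain ⟨Λ, hΛ, c, hc, hbig⟩ := totalVertexSum_lower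
  have hV : VertexVanishes anchorDomain Λ := fun K hK hKD =>
    (parafermionPrecompact_iff_vanishing.1 hP) anchorDomain Λ hΛ K hK hKD
  exact ⟨Λ, hΛ, c / 2, by positivity, fun h hh => collar_lower hΛ hc hbig hV hh⟩

/-- **`CollarSmall`** — the hypothesis-free collar statement: along every discretisation family of the diagonal
anchor square, for every `η > 0` some fixed collar width `h > 0` carries `‖collarSum_h‖ ≤ η δ^{-5/3}` frequently as
`δ → 0⁺`.  Shape: signed, integrated over the collar, one domain — weaker in shape than the uniform inner envelope of
crux 11387 (which gives `‖collarSum_h‖ ≤ 480 C (4h)^{2/3} δ^{-5/3}` eventually, the near half of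
`TotalSmall.norm_totalVertexSum_le`) and with no vanishing hypothesis (unlike `StrategistCensus2.AnchorLayerSmall`).
A statement, not asserted here. [folklore] -/
def CollarSmall : Prop :=
  ∀ Λ : ℝ → DiscreteDobrushin, IsFamily anchorDomain Λ → ∀ η > (0:ℝ), ∃ h > (0:ℝ),
    ∃ᶠ δ in 𝓝[>] (0:ℝ), ‖collarSum (Λ δ) δ h‖ ≤ η * δ ^ (-(5:ℝ) / 3)

/-- **`CollarSmall` refutes the typed decl** (`typed_collar_lower` at `η = c/2`). [folklore] -/
theorem typed_false_of_collarSmall (hS : CollarSmall) : ¬ ParafermionPrecompact := by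
  intro hP
  obtain ⟨Λ, hΛ, c, hc, hcol⟩ := typed_collar_lower hP
  obtain ⟨h, hh, hfreq⟩ := hS Λ hΛ (c / 2) (by positivity)
  have hpos : ∀ᶠ δ in 𝓝[>] (0:ℝ), (0:ℝ) < δ := eventually_mem_nhdsWithin
  obtain ⟨δ, hle, hge, hδ0⟩ := (hfreq.and_eventually ((hcol h hh).and hpos)).exists
  have hpow : (0:ℝ) < δ ^ (-(5:ℝ) / 3) := Real.rpow_pos_of_pos hδ0 _
  have : c * δ ^ (-(5:ℝ) / 3) ≤ c / 2 * δ ^ (-(5:ℝ) / 3) := hge.trans hle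
  nlinarith

/-- **`CollarSmall → H`**: the collar statement PROVES Duminil-Copin–Smirnov's bulk non-degeneracy of the spin-`1/3`
parafermion of bond percolation on `ℤ²` (`ParafermionBulkNondegenerate`, `[status: open]`), through
`¬typed ↔ H` (p74235/p141764). So `UIE ⇒ CollarSmall ⇒ H ⇔ ¬typed`: a junction for the negation side strictly
between crux 11387's envelope and `H`. [folklore] -/
theorem H_of_collarSmall (hS : CollarSmall) : ParafermionBulkNondegenerate :=
  not_parafermionPrecompact_iff_bulkNondegenerate.1 (typed_false_of_collarSmall hS)

/-- The dichotomy in one line: either some collar is small along some anchor family (and then `H` holds and the item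
closes `refuted`), or the typed decl's own consequence `typed_collar_lower` stands — never both. [folklore] -/
theorem collar_dichotomy : CollarSmall → ParafermionBulkNondegenerate ∧ ¬ ParafermionPrecompact :=
  fun hS => ⟨H_of_collarSmall hS, typed_false_of_collarSmall hS⟩

/-! ## §3 The sandwich `UIE ⇒ CollarSmall ⇒ H` -/

/-- **The collar at one scale under the envelope** (the near half of `TotalSmall.norm_totalVertexSum_le`, isolated).
Admissible data on the anchor square at mesh `δ ≤ min(h,1)`, lattice diamond of size `L`, envelope constant `C ≥ 1`
at every corner of lattice depth `R ≥ 1`: `‖collarSum E δ h‖ ≤ 480 C (4h/δ)^{2/3}/δ` — a collar vertex has depth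
`≤ M = ⌊2h/δ⌋ + 1` and carries `8C(dep+1)^{-1/3}` (`norm_vertexObs_le_profile`), each depth layer has
`≤ 8(2L+1) ≤ 40/δ` vertices (`card_fiber_le`), and `Σ_{n ≤ M} (n+1)^{-1/3} ≤ (3/2)(M+1)^{2/3}`. [folklore] -/
theorem norm_collarSum_le {E : DiscreteDobrushin} {δ : ℝ} {L : ℤ} {C : ℝ} (hE : E.IsZdAdmissible)
    (hEδ : E.δ = δ) (hLδ : (L : ℝ) * δ < 2) (hL1 : 2 ≤ ((L : ℝ) + 1) * δ)
    (hmesh : ∀ v : Site 2, v ∈ meshDomain E.Ω δ ↔ |v 0 + v 1| ≤ L ∧ |v 0 - v 1| ≤ L)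
    {h : ℝ} (hδh : δ ≤ h) (hδ1 : δ ≤ 1) (hC : 1 ≤ C)
    (hUIE : ∀ (v f : Site 2), IsCorner v f → ∀ R : ℕ, 1 ≤ R →
      (R : ℝ) * δ ≤ infDist (meshPoint δ v) anchorDomain.carrierᶜ → ‖cornerObs E δ v f‖ ≤ C * (R : ℝ) ^ (-(1:ℝ) / 3)) :
    ‖collarSum E δ h‖ ≤ 480 * C * (4 * h / δ) ^ ((2:ℝ) / 3) / δ := by
  classical
  have hδ : 0 < δ := hEδ ▸ hE.delta_pos
  have hh : 0 < h := lt_of_lt_of_le hδ hδh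
  have hL0 : 0 ≤ L := anchor_level_nonneg hδ hL1
  have hL0' : (0:ℝ) ≤ L := by exact_mod_cast hL0
  have h2L : 2 * (L : ℝ) + 1 ≤ 5 / δ := by
    rw [le_div_iff₀ hδ]; nlinarith
  set RS := (finite_random hE).toFinset with hRSdef
  have hRS : ∀ p, p ∈ RS ↔ IsRandomMV E p := fun p => Set.Finite.mem_toFinset _
  have hdia : ∀ p ∈ RS, |p.1 0 + p.1 1| ≤ L ∧ |p.1 0 - p.1 1| ≤ L := fun p hp =>
    (hmesh p.1).1 (hEδ ▸ (mem_meshDomain_of_random ((hRS p).1 hp)).1)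
  set near : Site 2 × Fin 2 → Prop := fun p => infDist (medialPoint δ (medialVertexOf p)) anchorDomain.carrierᶜ < h
    with hneardef
  have hcol : ‖collarSum E δ h‖ ≤ ∑ p ∈ RS.filter near, ‖vertexObs E δ (medialVertexOf p)‖ := by
    unfold collarSum
    rw [finsum_eq_sum_of_support_subset (s := RS.filter near)]
    · refine (norm_sum_le _ _).trans (Finset.sum_le_sum fun p hp => ?_)
      rw [if_pos ⟨(hRS p).1 (Finset.mem_filter.1 hp).1, (Finset.mem_filter.1 hp).2⟩]
    · intro p hp
      have hc := (ite_ne_right_iff.1 (Function.mem_support.1 hp)).1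
      exact Finset.mem_coe.2 (Finset.mem_filter.2 ⟨(hRS p).2 hc.1, hc.2⟩)
  set M : ℕ := ⌊2 * h / δ⌋₊ + 1 with hM
  have hM1 : ((M + 1 : ℕ) : ℝ) ≤ 4 * h / δ := by
    rw [hM]; push_cast
    have h1 := Nat.floor_le (by positivity : (0:ℝ) ≤ 2 * h / δ)
    have h2 : (2:ℝ) ≤ 2 * h / δ := by rw [le_div_iff₀ hδ]; linarith
    have h3 : 2 * h / δ + 2 * h / δ = 4 * h / δ := by ring
    linarith
  have hnear_dep : ∀ p ∈ RS.filter near,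
      (L - max |p.1 0 + p.1 1| |p.1 0 - p.1 1|).toNat ∈ Finset.range (M + 1) := by
    intro p hp
    obtain ⟨hpR, hpf⟩ := Finset.mem_filter.1 hp
    set n : ℕ := (L - max |p.1 0 + p.1 1| |p.1 0 - p.1 1|).toNat with hn
    have hpf' : infDist (medialPoint δ (medialVertexOf p)) anchorDomain.carrierᶜ < h := hpf
    have h1 := le_infDist_meshPoint hδ hLδ p.1
    have h2 := Metric.infDist_le_infDist_add_dist (x := meshPoint δ p.1) (y := medialPoint δ (medialVertexOf p))
      (s := anchorDomain.carrierᶜ)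
    have h3 : dist (meshPoint δ p.1) (medialPoint δ (medialVertexOf p)) ≤ δ / 2 := by
      rw [dist_eq_norm]; exact S6.norm_meshPoint_fst_sub_medialPoint hδ.le p
    have hcast : ((n : ℕ) : ℝ) = (L : ℝ) - (max |p.1 0 + p.1 1| |p.1 0 - p.1 1| : ℤ) := by
      have := cast_dep (hdia p hpR); rw [← hn] at this; exact_mod_cast this
    rw [← hcast] at h1
    have h4 : ((n : ℕ) : ℝ) * δ < 2 * h + δ := by nlinarith
    have h5 : ((n : ℕ) : ℝ) < 2 * h / δ + 1 := by
      rw [div_add_one hδ.ne', lt_div_iff₀ hδ]; linarith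
    have h6 := Nat.lt_floor_add_one (2 * h / δ)
    rw [Finset.mem_range]
    have : ((n : ℕ) : ℝ) < ((M + 1 : ℕ) : ℝ) := by rw [hM]; push_cast; linarith
    exact_mod_cast this
  have hdia' : ∀ p ∈ RS.filter near, |p.1 0 + p.1 1| ≤ L ∧ |p.1 0 - p.1 1| ≤ L :=
    fun p hp => hdia p (Finset.mem_filter.1 hp).1
  have hnear : ∑ p ∈ RS.filter near, ‖vertexObs E δ (medialVertexOf p)‖ ≤
      480 * C * (4 * h / δ) ^ ((2:ℝ) / 3) / δ := by
    calc ∑ p ∈ RS.filter near, ‖vertexObs E δ (medialVertexOf p)‖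
        ≤ ∑ p ∈ RS.filter near,
            8 * C * (((L - max |p.1 0 + p.1 1| |p.1 0 - p.1 1|).toNat + 1 : ℕ) : ℝ) ^ (-(1:ℝ) / 3) :=
          Finset.sum_le_sum fun p hp =>
            norm_vertexObs_le_profile hE hδ hLδ hC hUIE ((hRS p).1 (Finset.mem_filter.1 hp).1) (hdia' p hp)
      _ = ∑ n ∈ Finset.range (M + 1), ∑ p ∈ (RS.filter near).filter
            (fun p => (L - max |p.1 0 + p.1 1| |p.1 0 - p.1 1|).toNat = n),
            8 * C * (((L - max |p.1 0 + p.1 1| |p.1 0 - p.1 1|).toNat + 1 : ℕ) : ℝ) ^ (-(1:ℝ) / 3) :=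
          (Finset.sum_fiberwise_of_maps_to hnear_dep _).symm
      _ ≤ ∑ n ∈ Finset.range (M + 1), 8 * (2 * (L : ℝ) + 1) * (8 * C * ((n + 1 : ℕ) : ℝ) ^ (-(1:ℝ) / 3)) := by
          refine Finset.sum_le_sum fun n _ => ?_
          rw [Finset.sum_congr rfl fun p hp => by rw [(Finset.mem_filter.1 hp).2], Finset.sum_const, nsmul_eq_mul]
          exact mul_le_mul_of_nonneg_right (card_fiber_le hL0 hdia' n) (by positivity)
      _ = 64 * C * (2 * (L : ℝ) + 1) * ∑ n ∈ Finset.range (M + 1), ((n + 1 : ℕ) : ℝ) ^ (-(1:ℝ) / 3) := by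
          rw [Finset.mul_sum]; exact Finset.sum_congr rfl fun n _ => by ring
      _ ≤ 64 * C * (2 * (L : ℝ) + 1) * (3 / 2 * ((M + 1 : ℕ) : ℝ) ^ ((2:ℝ) / 3)) := by
          gcongr
          exact S6.sum_rpow_neg_third_le (M + 1)
      _ ≤ 64 * C * (5 / δ) * (3 / 2 * (4 * h / δ) ^ ((2:ℝ) / 3)) := by gcongr
      _ = 480 * C * (4 * h / δ) ^ ((2:ℝ) / 3) / δ := by field_simp; ring
  exact hcol.trans hnear

/-- **`UIE ⇒ CollarSmall`**: under crux 11387's uniform inner envelope the collar of width `h` carries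
`≤ 480 C (4h)^{2/3} δ^{-5/3}` eventually along any anchor family, so for `η > 0` the width `h` with
`(4h)^{2/3} ≤ η/(480 C)` witnesses `CollarSmall` (eventually, a fortiori frequently). With `H_of_collarSmall` this
certifies the sandwich `UIE ⇒ CollarSmall ⇒ H ⇔ ¬typed`. [folklore] -/
theorem collarSmall_of_UIE (hU : UniformInnerEnvelope) : CollarSmall := by
  intro Λ hΛ η hη
  obtain ⟨C₀, hC₀⟩ := hU
  obtain ⟨C, hCdef⟩ : ∃ C : ℝ, C = max C₀ 1 := ⟨_, rfl⟩
  have hC : 1 ≤ C := hCdef ▸ le_max_right _ _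
  have hCC₀ : C₀ ≤ C := hCdef ▸ le_max_left _ _
  have hpow : Filter.Tendsto (fun x : ℝ => (4 * x) ^ ((2:ℝ) / 3)) (𝓝[>] (0:ℝ)) (𝓝 0) := by
    have hc : Continuous (fun x : ℝ => (4 * x) ^ ((2:ℝ) / 3)) :=
      (continuous_const.mul continuous_id).rpow_const fun x => Or.inr (by norm_num)
    simpa [Real.zero_rpow (by norm_num : ((2:ℝ) / 3) ≠ 0)] using tendsto_nhdsWithin_of_tendsto_nhds (hc.tendsto 0)
  obtain ⟨h, hh1, hh0, hh2⟩ := ((hpow.eventually_le_const (by positivity : (0:ℝ) < η / (480 * C))).and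
    (Ioo_mem_nhdsGT (zero_lt_one' ℝ))).exists
  refine ⟨h, hh0, Filter.Eventually.frequently ?_⟩
  filter_upwards [anchor_geometry hΛ, Ioo_mem_nhdsGT hh0] with δ hgeom hδI
  obtain ⟨hδ0, hδh⟩ := hδI
  obtain ⟨L, -, hLδ, hL1, hE, hEδ, hΩ, hmesh, -⟩ := hgeom
  have hUIE' : ∀ (v f : Site 2), IsCorner v f → ∀ R : ℕ, 1 ≤ R →
      (R : ℝ) * δ ≤ infDist (meshPoint δ v) anchorDomain.carrierᶜ →
        ‖cornerObs (Λ δ) δ v f‖ ≤ C * (R : ℝ) ^ (-(1:ℝ) / 3) := by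
    intro v f hvf R hR hRd
    have h1 := hC₀ anchorDomain (Λ δ) hΩ hE v f hvf R hR (by rw [hEδ]; exact hRd)
    rw [hEδ] at h1
    exact h1.trans (mul_le_mul_of_nonneg_right hCC₀ (Real.rpow_nonneg (Nat.cast_nonneg R) _))
  have main := norm_collarSum_le hE hEδ hLδ hL1 hmesh hδh.le (hδh.le.trans hh2.le) hC hUIE'
  have hid : 480 * C * (4 * h / δ) ^ ((2:ℝ) / 3) / δ = 480 * C * (4 * h) ^ ((2:ℝ) / 3) * δ ^ (-(5:ℝ) / 3) := by
    have := TotalSmall.scale_identity (C := C) (ε := 0) hδ0 hh0.le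
    simpa only [zero_mul, mul_zero, add_zero] using this
  rw [hid] at main
  refine main.trans (mul_le_mul_of_nonneg_right ?_ (Real.rpow_nonneg hδ0.le _))
  calc 480 * C * (4 * h) ^ ((2:ℝ) / 3) ≤ 480 * C * (η / (480 * C)) := by gcongr
    _ = η := by field_simp

/-- The certified sandwich, by name: `UIE → CollarSmall`, `CollarSmall → H`, `H ↔ ¬typed`. [folklore] -/
theorem sandwich :
    (UniformInnerEnvelope → CollarSmall) ∧ (CollarSmall → ParafermionBulkNondegenerate) ∧
      (ParafermionBulkNondegenerate ↔ ¬ ParafermionPrecompact) :=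
  ⟨collarSmall_of_UIE, H_of_collarSmall, not_parafermionPrecompact_iff_bulkNondegenerate.symm⟩

end Summit.CriticalPhenomena.CardyFormulaZ2.Cruxes.ParafermionPrecompact.StrategistCensusR1

end
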